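/-
Copyright (c) 2026 the pub-hodgecm-mathlib formalisation cell (harness21).  Prover seat hodgecm-mathlib-K2E3-p11 (g5), Track B «K2-LIT» ∕ h413
(`stmt-HodgeConjecture-24833`), line `K2_E3_EllipticInputs`, unit U12 §L, Richardson road for (LBGL-ge3) at `N = 3` (road owner K2E3-p11), brick (F-E) =
(LBGL-3E) «THE (2,1)-PARABOLIC SLICE DENSITY OF 𝔤𝔩₃(F)», FILE G″1 «BOX ARITHMETIC FOR THE PARABOLIC CHART: the level set meets the chart's preimage of `V_j(m)` in exactly the box».  2026-09-04.
-/
import Summits.HodgeConjecture.HodgeConjecture.Theorems.K2E3GL3ParabolicOrbitChart           -- ★ E″2 p857776 (this seat): `exists_depth_parabolicChart` (+ ★ E″1 `K2E3GL3ParabolicChartDeriv` §1 algebra)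
import Literature.NumberTheory.Automorphic.AddCharConductorExponent                          -- ★ `primePowBall` kit: `add_mem_∕neg_mem_primePowBall`, `primePowBall_antitone`, `exists_mem_primePowBall`
import HarnessLib

/-!
# K2_E3 road (h413), §L ∕ Richardson road at `N = 3`, brick (F-E) FILE G″1: box arithmetic for the parabolic chart and THE SET IDENTITY

Cell `pub/hodgecm-mathlib` (D-0151), Track B, seat K2E3-p11 (g5) (road owner of (F-E) = (LBGL-3E) `sig_K2E3GL3ParabolicSliceDensity`; ROAD v2 on `K2/STATUS.md`,
2026-09-04).  `--supports stmt-HodgeConjecture-24833 --as helper`; THEOREMS ONLY (no definition ∕ instance ∕ notation ∕ named fact ∕ `sorry`); never imports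
`Cruxes/…/Lines`.  COUNT-NEUTRAL.

THE POINT.  ROAD v2 computes the (2,1)-parabolic slice `ρ(f) = ∫_K ∫_𝔭 f(Ad(k)P) dP dk` near a `(G,M)`-regular Levi point `M(m) = [[m₀,m₁,0],[m₂,m₃,0],[0,0,m₄]]`
(`χ(m) = χ_A(m₄) ≠ 0`) by splitting `k = (1 + L z)·p` (`p ∈ K ∩ P`, `z ∈ (𝔭^{j'})²` — brick F″) and absorbing `Ad(p)` into `dP` (★ P″).  What is left is the
`(z, r)`-integral of this file:
  `∫⁻_{z ∈ (𝔭^{j'})²} ∫⁻_{r ∈ F⁷} (1_{V_j(m)}·h)((1 + L z) P(r) (1 + L z)⁻¹) dr dz = c · ‖χ(m)‖_F⁻¹ · ∫⁻_{V_j(m)} h dμ𝔤`      (`j₀(m) ≤ j' ≤ j`)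
with `V_j(m) = M(m) + e_m(M₃(𝔭^j))` the image of the depth chart ★ E″2 and ONE constant `c = c(μ𝔤, dx)` (the module between `μ𝔤` and the coordinate measure
`dz dr`).  Two steps: (i) `(1 + L z) P(r) (1 − L z) = Φ_m(X(z,r))` with `X(z,r) = L z + (P(r) − M(m))`, and `(z, r) ↦ X(z, r) + M(m)` carries `dz ⊗ dr` to `c·μ𝔤`
(Haar uniqueness on `M₃(F)`), so the left side is `c ∫⁻_{T_{j'} ∩ Φ_m⁻¹ V_j(m)} h ∘ Φ_m dμ𝔤`, `T_{j'} = {X | X₂₀, X₂₁ ∈ 𝔭^{j'}}`; (ii) THE SET IDENTITY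
`T_{j'} ∩ Φ_m⁻¹(V_j(m)) = M₃(𝔭^j)` for `k₀ + c₀ ≤ j' ≤ j` (valuation bookkeeping: `X_𝔭 = (1 − Lz)(Φ_m X)(1 + Lz) − M(m) ∈ M₃(𝔭^{j'−c₀})`, then injectivity of
`Φ_m` on `M₃(𝔭^{k₀})` ★ E″2 (a) and `Φ_m(M₃(𝔭^j)) = V_j(m)` ★ E″2 (b)); then ★ E″2 (d) turns `∫⁻_{M₃(𝔭^j)} h ∘ Φ_m` into `‖χ(m)‖⁻¹ ∫⁻_{V_j(m)} h`.
* §1 box arithmetic in `M₃(F)` (`primePowBall` entries of products ∕ of the row action ∕ a bound `c₀` for `m` ∕ inverting the chart on the level set);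
* §2 **`setOf_inter_preimage_parabolicChart_eq_box`** (the set identity).  FILE G″2 `K2E3GL3ParabolicSliceLocalPullback` does the `(z, r)`-integral over it.
[HarishChandra1999AdmissibleDistributions, §7 Lemma 7.8] [HarishChandra1970, Part V §4 Lemma 22] [WeilBNT1967, Ch. I §2]
HONEST LABEL: HC_CM is proved only modulo the 7 printed citations (2 remaining named inputs: hLiu418 = stmt-HodgeConjecture-24832, h413 = stmt-HodgeConjecture-24833)
until rung 0 closes; count-neutral helper ((LBGL-ge3)∕(LBGL-3E) NOT ★ here).

## References
* [HarishChandra1999AdmissibleDistributions] Harish-Chandra (DeBacker–Sally), *Admissible Invariant Distributions on Reductive p-adic Groups* (1999), §7, Lemma 7.8.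
* [HarishChandra1970] Harish-Chandra (van Dijk), *Harmonic Analysis on Reductive p-adic Groups*, LNM 162 (1970), Part V §4 Lemma 22.
* [WeilBNT1967] A. Weil, *Basic Number Theory* (1967), Ch. I §2.
-/

set_option autoImplicit false
set_option linter.dupNamespace false

noncomputable section

open MeasureTheory Measure Filter Topology Set Matrix
open scoped MatrixGroups NNReal ENNReal Pointwise
open Literature.NumberTheory.Automorphic Literature.NumberTheory.Automorphic.LocalFieldHaar
open Literature.NumberTheory.GaloisRepresentations Literature.NumberTheory.GaloisRepresentations.IsNonarchimedeanLocalField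
open Summit.HodgeConjecture.HodgeConjecture.Cruxes.H413.K2E3GLnMaximalParabolicDescent
open Summit.HodgeConjecture.HodgeConjecture.Cruxes.H413.K2E3GL3ParabolicChartDeriv
open Summit.HodgeConjecture.HodgeConjecture.Cruxes.H413.K2E3GL3ParabolicOrbitChart

namespace Summit.HodgeConjecture.HodgeConjecture.Cruxes.H413.K2E3GL3ParabolicChartBoxes

/-! ## §1  Box arithmetic in `M₃(F)` -/

section Boxes

variable {F : Type*} [Field F] [ValuativeRel F] [TopologicalSpace F] [IsNonarchimedeanLocalField F]

/-- Entries of a product: `A ∈ M₃(𝔭^a)`, `B ∈ M₃(𝔭^b)` ⇒ `AB ∈ M₃(𝔭^{a+b})`. [folklore] -/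
theorem mul_apply_mem_primePowBall_add {a b : ℤ} {A B : Matrix (Fin 3) (Fin 3) F}
    (hA : ∀ i l, A i l ∈ primePowBall F a) (hB : ∀ i l, B i l ∈ primePowBall F b) (i l : Fin 3) :
    (A * B) i l ∈ primePowBall F (a + b) := by
  rw [Matrix.mul_apply, Fin.sum_univ_three]
  exact add_mem_primePowBall (add_mem_primePowBall (mul_mem_primePowBall (hA i 0) (hB 0 l)) (mul_mem_primePowBall (hA i 1) (hB 1 l)))
    (mul_mem_primePowBall (hA i 2) (hB 2 l))

/-- `A, B ∈ M₃(𝔭^a)` ⇒ `A + B ∈ M₃(𝔭^a)` and `A − B ∈ M₃(𝔭^a)`. [folklore] -/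
theorem sub_apply_mem_primePowBall {a : ℤ} {A B : Matrix (Fin 3) (Fin 3) F}
    (hA : ∀ i l, A i l ∈ primePowBall F a) (hB : ∀ i l, B i l ∈ primePowBall F a) (i l : Fin 3) :
    (A - B) i l ∈ primePowBall F a := by
  rw [Matrix.sub_apply, sub_eq_add_neg]
  exact add_mem_primePowBall (hA i l) (neg_mem_primePowBall (hB i l))

/-- **A common bound for the Levi datum**: `m₀, …, m₄ ∈ 𝔭^{−c₀}` for some `c₀ ∈ ℕ`. [folklore] -/
theorem exists_forall_mem_primePowBall_neg (m : Fin 5 → F) : ∃ c₀ : ℕ, ∀ i, m i ∈ primePowBall F (-(c₀ : ℤ)) := by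
  choose k hk using fun i => exists_mem_primePowBall (m i)
  refine ⟨Finset.univ.sup fun i => (-(k i)).toNat, fun i => primePowBall_antitone ?_ (hk i)⟩
  have h1 : (-(k i)).toNat ≤ Finset.univ.sup fun i => (-(k i)).toNat := Finset.le_sup (f := fun i => (-(k i)).toNat) (Finset.mem_univ i)
  have h2 : -(k i) ≤ ((-(k i)).toNat : ℤ) := Int.self_le_toNat _
  omega

/-- `M(m) ∈ M₃(𝔭^{−c₀})`. [folklore] -/
theorem leviBlock_apply_mem_primePowBall {m : Fin 5 → F} {c₀ : ℕ} (hc₀ : ∀ i, m i ∈ primePowBall F (-(c₀ : ℤ))) (i l : Fin 3) :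
    (!![m 0, m 1, 0; m 2, m 3, 0; 0, 0, m 4] : Matrix (Fin 3) (Fin 3) F) i l ∈ primePowBall F (-(c₀ : ℤ)) := by
  fin_cases i <;> fin_cases l
  all_goals first | exact hc₀ _ | exact zero_mem_primePowBall _

/-- **The row action shifts boxes by at most `c₀`**: `e_m(M₃(𝔭^j)) ⊆ M₃(𝔭^{j−c₀})`. [folklore] -/
theorem rowAction_apply_mem_primePowBall {m : Fin 5 → F} {c₀ : ℕ} (hc₀ : ∀ i, m i ∈ primePowBall F (-(c₀ : ℤ)))
    {t : ℤ} {X : Matrix (Fin 3) (Fin 3) F} (hX : ∀ i l, X i l ∈ primePowBall F t) (i l : Fin 3) :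
    (!![X 0 0, X 0 1, X 0 2; X 1 0, X 1 1, X 1 2; X 2 0 * (m 0 - m 4) + X 2 1 * m 2, X 2 0 * m 1 + X 2 1 * (m 3 - m 4), X 2 2] :
      Matrix (Fin 3) (Fin 3) F) i l ∈ primePowBall F (t - c₀) := by
  have hle : t - c₀ ≤ t := by omega
  have hsub : ∀ a b : Fin 5, m a - m b ∈ primePowBall F (-(c₀ : ℤ)) := fun a b => by
    rw [sub_eq_add_neg]; exact add_mem_primePowBall (hc₀ a) (neg_mem_primePowBall (hc₀ b))
  have h20 : X 2 0 * (m 0 - m 4) + X 2 1 * m 2 ∈ primePowBall F (t - c₀) := by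
    rw [sub_eq_add_neg t]
    exact add_mem_primePowBall (mul_mem_primePowBall (hX 2 0) (hsub 0 4)) (mul_mem_primePowBall (hX 2 1) (hc₀ 2))
  have h21 : X 2 0 * m 1 + X 2 1 * (m 3 - m 4) ∈ primePowBall F (t - c₀) := by
    rw [sub_eq_add_neg t]
    exact add_mem_primePowBall (mul_mem_primePowBall (hX 2 0) (hc₀ 1)) (mul_mem_primePowBall (hX 2 1) (hsub 3 4))
  fin_cases i <;> fin_cases l
  all_goals first | exact h20 | exact h21 | exact primePowBall_antitone hle (hX _ _)

/-- `V_j(m) = M(m) + e_m(M₃(𝔭^j)) ⊆ M(m) + M₃(𝔭^{j−c₀})`: every `Y ∈ V_j(m)` has `Y − M(m) ∈ M₃(𝔭^{j−c₀})`. [folklore] -/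
theorem sub_leviBlock_mem_of_mem_imageRowAction {m : Fin 5 → F} {c₀ : ℕ} (hc₀ : ∀ i, m i ∈ primePowBall F (-(c₀ : ℤ))) {t : ℤ}
    {Y : Matrix (Fin 3) (Fin 3) F}
    (hY : Y ∈ (!![m 0, m 1, 0; m 2, m 3, 0; 0, 0, m 4] : Matrix (Fin 3) (Fin 3) F) +ᵥ
      ((fun X : Matrix (Fin 3) (Fin 3) F =>
          (!![X 0 0, X 0 1, X 0 2; X 1 0, X 1 1, X 1 2; X 2 0 * (m 0 - m 4) + X 2 1 * m 2, X 2 0 * m 1 + X 2 1 * (m 3 - m 4), X 2 2] :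
            Matrix (Fin 3) (Fin 3) F)) '' {X : Matrix (Fin 3) (Fin 3) F | ∀ i l, X i l ∈ primePowBall F t})) (i l : Fin 3) :
    (Y - !![m 0, m 1, 0; m 2, m 3, 0; 0, 0, m 4]) i l ∈ primePowBall F (t - c₀) := by
  obtain ⟨W, ⟨X, hX, rfl⟩, rfl⟩ := Set.mem_vadd_set.1 hY
  rw [vadd_eq_add, add_sub_cancel_left]
  exact rowAction_apply_mem_primePowBall hc₀ hX i l

/-- **Inverting the chart on the level set**: if `X₂₀, X₂₁ ∈ 𝔭^{j'}` and `Φ_m(X) − M(m) ∈ M₃(𝔭^{j'−c₀})` (with `m ∈ (𝔭^{−c₀})⁵`, `0 ≤ j'`), then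
`X ∈ M₃(𝔭^{j'−c₀})` — because `X_𝔭 = (1 − L X)·Φ_m(X)·(1 + L X) − M(m)`. [folklore] -/
theorem mem_box_of_parabolicChart_sub_mem {m : Fin 5 → F} {c₀ : ℕ} (hc₀ : ∀ i, m i ∈ primePowBall F (-(c₀ : ℤ))) {j' : ℕ}
    {X : Matrix (Fin 3) (Fin 3) F} (h20 : X 2 0 ∈ primePowBall F (j' : ℤ)) (h21 : X 2 1 ∈ primePowBall F (j' : ℤ))
    (hΦX : ∀ i l, ((1 + (!![0, 0, 0; 0, 0, 0; X 2 0, X 2 1, 0] : Matrix (Fin 3) (Fin 3) F)) *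
          (!![m 0, m 1, 0; m 2, m 3, 0; 0, 0, m 4] + !![X 0 0, X 0 1, X 0 2; X 1 0, X 1 1, X 1 2; 0, 0, X 2 2]) *
          (1 - !![0, 0, 0; 0, 0, 0; X 2 0, X 2 1, 0]) - !![m 0, m 1, 0; m 2, m 3, 0; 0, 0, m 4]) i l ∈ primePowBall F ((j' : ℤ) - c₀)) :
    ∀ i l, X i l ∈ primePowBall F ((j' : ℤ) - c₀) := by
  set L : Matrix (Fin 3) (Fin 3) F := !![0, 0, 0; 0, 0, 0; X 2 0, X 2 1, 0] with hL
  set Xp : Matrix (Fin 3) (Fin 3) F := !![X 0 0, X 0 1, X 0 2; X 1 0, X 1 1, X 1 2; 0, 0, X 2 2] with hXp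
  set M₀ : Matrix (Fin 3) (Fin 3) F := !![m 0, m 1, 0; m 2, m 3, 0; 0, 0, m 4] with hM₀
  set Y : Matrix (Fin 3) (Fin 3) F := (1 + L) * (M₀ + Xp) * (1 - L) with hY
  -- `X_𝔭 = (1 − L) Y (1 + L) − M₀ = δ + Y L − L Y − L Y L`, `δ = Y − M₀`
  have h1 : (1 - L) * (1 + L) = 1 := one_sub_lowerRow_mul_one_add X
  have hXp_eq : Xp = (Y - M₀) + Y * L - L * Y - L * Y * L := by
    have h2 : (1 - L) * Y * (1 + L) = M₀ + Xp := by
      rw [hY, show (1 - L) * ((1 + L) * (M₀ + Xp) * (1 - L)) * (1 + L) = ((1 - L) * (1 + L)) * (M₀ + Xp) * ((1 - L) * (1 + L)) by noncomm_ring,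
        h1, Matrix.one_mul, Matrix.mul_one]
    have h3 : (1 - L) * Y * (1 + L) = Y + Y * L - L * Y - L * Y * L := by noncomm_ring
    rw [h3] at h2
    -- `h2 : Y + Y L − L Y − L Y L = M₀ + Xp`
    have h4 : Xp = (Y + Y * L - L * Y - L * Y * L) - M₀ := by rw [h2]; abel
    rw [h4]; abel
  -- box memberships
  have hLb : ∀ i l, L i l ∈ primePowBall F (j' : ℤ) := by
    intro i l; fin_cases i <;> fin_cases l
    all_goals first | exact h20 | exact h21 | exact zero_mem_primePowBall _
  have hδ : ∀ i l, (Y - M₀) i l ∈ primePowBall F ((j' : ℤ) - c₀) := hΦX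
  have hc₀le : -(c₀ : ℤ) ≤ (j' : ℤ) - c₀ := by omega
  have hYb : ∀ i l, Y i l ∈ primePowBall F (-(c₀ : ℤ)) := by
    intro i l
    have h : Y = (Y - M₀) + M₀ := (sub_add_cancel Y M₀).symm
    rw [h, Matrix.add_apply]
    exact add_mem_primePowBall (primePowBall_antitone hc₀le (hδ i l)) (leviBlock_apply_mem_primePowBall hc₀ i l)
  have hYL : ∀ i l, (Y * L) i l ∈ primePowBall F ((j' : ℤ) - c₀) := fun i l => by
    have h := mul_apply_mem_primePowBall_add hYb hLb i l
    rwa [show -(c₀ : ℤ) + j' = (j' : ℤ) - c₀ by omega] at h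
  have hLY : ∀ i l, (L * Y) i l ∈ primePowBall F ((j' : ℤ) - c₀) := fun i l => by
    have h := mul_apply_mem_primePowBall_add hLb hYb i l
    rwa [show (j' : ℤ) + -(c₀ : ℤ) = (j' : ℤ) - c₀ by omega] at h
  have hLYL : ∀ i l, (L * Y * L) i l ∈ primePowBall F ((j' : ℤ) - c₀) := fun i l =>
    primePowBall_antitone (show (j' : ℤ) - c₀ ≤ (j' : ℤ) - c₀ + j' by omega) (mul_apply_mem_primePowBall_add hLY hLb i l)
  have hXpb : ∀ i l, Xp i l ∈ primePowBall F ((j' : ℤ) - c₀) := by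
    intro i l
    rw [hXp_eq]
    exact sub_apply_mem_primePowBall (sub_apply_mem_primePowBall (fun i l => by
      rw [Matrix.add_apply]; exact add_mem_primePowBall (hδ i l) (hYL i l)) hLY) hLYL i l
  -- read off the entries of `X = L + X_𝔭`
  have hj : (j' : ℤ) - c₀ ≤ j' := by omega
  intro i l
  fin_cases i <;> fin_cases l
  · exact hXpb 0 0
  · exact hXpb 0 1
  · exact hXpb 0 2
  · exact hXpb 1 0
  · exact hXpb 1 1
  · exact hXpb 1 2
  · exact primePowBall_antitone hj h20
  · exact primePowBall_antitone hj h21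
  · exact hXpb 2 2

end Boxes

/-! ## §2  The set identity: the level set meets the chart's preimage of `V_j(m)` in exactly the box `M₃(𝔭^j)` -/

section SetIdentity

variable {F : Type*} [Field F] [ValuativeRel F] [TopologicalSpace F] [IsNonarchimedeanLocalField F]

/-- **THE SET IDENTITY.**  Let `Φ = Φ_m` be the parabolic chart, injective on `M₃(𝔭^{k₀})` with `Φ(M₃(𝔭^j)) = V_j(m) := M(m) + e_m(M₃(𝔭^j))` (★ E″2 (a)(b)), and let
`m ∈ (𝔭^{−c₀})⁵`.  Then for `k₀ + c₀ ≤ j' ≤ j`:  `{X | X₂₀, X₂₁ ∈ 𝔭^{j'}} ∩ Φ⁻¹(V_j(m)) = M₃(𝔭^j)`.  (⊆: such an `X` lies in `M₃(𝔭^{j'−c₀}) ⊆ M₃(𝔭^{k₀})` by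
§1, and `Φ X = Φ X'` with `X' ∈ M₃(𝔭^j)` forces `X = X'`.) [cite: HarishChandra1999AdmissibleDistributions, §7 Lemma 7.8] -/
theorem setOf_inter_preimage_parabolicChart_eq_box (m : Fin 5 → F) {c₀ : ℕ} (hc₀ : ∀ i, m i ∈ primePowBall F (-(c₀ : ℤ)))
    (Φ : Matrix (Fin 3) (Fin 3) F → Matrix (Fin 3) (Fin 3) F)
    (hΦ : Φ = fun X : Matrix (Fin 3) (Fin 3) F =>
        (1 + (!![0, 0, 0; 0, 0, 0; X 2 0, X 2 1, 0] : Matrix (Fin 3) (Fin 3) F)) *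
          (!![m 0, m 1, 0; m 2, m 3, 0; 0, 0, m 4] + !![X 0 0, X 0 1, X 0 2; X 1 0, X 1 1, X 1 2; 0, 0, X 2 2]) *
          (1 - !![0, 0, 0; 0, 0, 0; X 2 0, X 2 1, 0]))
    {k₀ j' j : ℕ} (hinj : Set.InjOn Φ {X : Matrix (Fin 3) (Fin 3) F | ∀ i l, X i l ∈ primePowBall F k₀})
    (himg : Φ '' {X : Matrix (Fin 3) (Fin 3) F | ∀ i l, X i l ∈ primePowBall F j} =
      (!![m 0, m 1, 0; m 2, m 3, 0; 0, 0, m 4] : Matrix (Fin 3) (Fin 3) F) +ᵥ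
        ((fun X : Matrix (Fin 3) (Fin 3) F =>
            (!![X 0 0, X 0 1, X 0 2; X 1 0, X 1 1, X 1 2; X 2 0 * (m 0 - m 4) + X 2 1 * m 2, X 2 0 * m 1 + X 2 1 * (m 3 - m 4), X 2 2] :
              Matrix (Fin 3) (Fin 3) F)) '' {X : Matrix (Fin 3) (Fin 3) F | ∀ i l, X i l ∈ primePowBall F j}))
    (hk : k₀ + c₀ ≤ j') (hj : j' ≤ j) :
    {X : Matrix (Fin 3) (Fin 3) F | X 2 0 ∈ primePowBall F (j' : ℤ) ∧ X 2 1 ∈ primePowBall F (j' : ℤ)} ∩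
        Φ ⁻¹' ((!![m 0, m 1, 0; m 2, m 3, 0; 0, 0, m 4] : Matrix (Fin 3) (Fin 3) F) +ᵥ
          ((fun X : Matrix (Fin 3) (Fin 3) F =>
              (!![X 0 0, X 0 1, X 0 2; X 1 0, X 1 1, X 1 2; X 2 0 * (m 0 - m 4) + X 2 1 * m 2, X 2 0 * m 1 + X 2 1 * (m 3 - m 4), X 2 2] :
                Matrix (Fin 3) (Fin 3) F)) '' {X : Matrix (Fin 3) (Fin 3) F | ∀ i l, X i l ∈ primePowBall F j})) =
      {X : Matrix (Fin 3) (Fin 3) F | ∀ i l, X i l ∈ primePowBall F j} := by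
  ext X
  refine ⟨fun hX => ?_, fun hX => ?_⟩
  · obtain ⟨⟨h20, h21⟩, hV⟩ := hX
    rw [Set.mem_preimage] at hV
    -- `Φ X − M(m) ∈ M₃(𝔭^{j − c₀}) ⊆ M₃(𝔭^{j' − c₀})`
    have hδ : ∀ i l, (Φ X - !![m 0, m 1, 0; m 2, m 3, 0; 0, 0, m 4]) i l ∈ primePowBall F ((j' : ℤ) - c₀) := fun i l =>
      primePowBall_antitone (by omega) (sub_leviBlock_mem_of_mem_imageRowAction hc₀ hV i l)
    have hΦX : ∀ i l, ((1 + (!![0, 0, 0; 0, 0, 0; X 2 0, X 2 1, 0] : Matrix (Fin 3) (Fin 3) F)) *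
          (!![m 0, m 1, 0; m 2, m 3, 0; 0, 0, m 4] + !![X 0 0, X 0 1, X 0 2; X 1 0, X 1 1, X 1 2; 0, 0, X 2 2]) *
          (1 - !![0, 0, 0; 0, 0, 0; X 2 0, X 2 1, 0]) - !![m 0, m 1, 0; m 2, m 3, 0; 0, 0, m 4]) i l ∈ primePowBall F ((j' : ℤ) - c₀) := by
      rw [hΦ] at hδ; exact hδ
    have hXbox : ∀ i l, X i l ∈ primePowBall F ((j' : ℤ) - c₀) := mem_box_of_parabolicChart_sub_mem hc₀ h20 h21 hΦX
    have hXk₀ : ∀ i l, X i l ∈ primePowBall F (k₀ : ℤ) := fun i l => primePowBall_antitone (by omega) (hXbox i l)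
    -- `Φ X ∈ Φ(M₃(𝔭^j))`, injectivity on `M₃(𝔭^{k₀})`
    rw [← himg] at hV
    obtain ⟨X', hX', hΦeq⟩ := hV
    have hX'k₀ : ∀ i l, X' i l ∈ primePowBall F (k₀ : ℤ) := fun i l =>
      primePowBall_antitone (by exact_mod_cast (le_trans (Nat.le_of_add_right_le hk) hj)) (hX' i l)
    have h := hinj hX'k₀ hXk₀ hΦeq
    rw [← h]
    exact hX'
  · refine ⟨⟨primePowBall_antitone (by exact_mod_cast hj) (hX 2 0), primePowBall_antitone (by exact_mod_cast hj) (hX 2 1)⟩, ?_⟩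
    rw [Set.mem_preimage, ← himg]
    exact Set.mem_image_of_mem Φ hX

end SetIdentity

end Summit.HodgeConjecture.HodgeConjecture.Cruxes.H413.K2E3GL3ParabolicChartBoxes

end
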